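import Summits.CriticalPhenomena.Ising3DConformalLimit.Theorems.HyperoctahedralRPExistsScaleCovariantLimitFoldedCurrentDefs
import Summits.CriticalPhenomena.Ising3DConformalLimit.Theorems.HyperoctahedralRPExistsScaleCovariantLimitFunnelDoublingIffAxisRate
import Literature.Probability.LatticeModels.BoxTwoPointTransfer
import Literature.Probability.LatticeModels.CriticalTwoPointBounds
import HarnessLib

/-!
# Line `folded-current-repulsion` (crux `ExistsScaleCovariantLimit`, stmt-CriticalPhenomena-1981): the engine is EXACTLY item 6150

Lead `prover-line-stmt-CriticalPhenomena-1981-c11-0`. Given Aizenman's folded random-current identity on the boxes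
(`FoldedIdentity`, stub F1 of the registered skeleton `Cruxes/ExistsScaleCovariantLimit/Lines/folded_current_repulsion.lean`),
the line's load-bearing statement `WallRepulsion` (F2: the folded critical current sourced at `−(k+1)e₀, −e₀` avoids the
mirror plane `{x₀ = 0}` with probability `≤ A/k` in every large box) is EQUIVALENT to item 6150
`MirrorHoelderCompactness.TwoPointDoubling` (all-scale axis doubling of the critical two-point function), through the
log-free axial gradient bound of Aizenman–Duminil-Copin 2021, Remark 5.10 (`Funnel.twoPointDoubling_iff_axisGradientRate`,
p132478):

* `axisGradientRate_of_wallRepulsion` : `FoldedIdentity → WallRepulsion → AxisGradientRate` (thermodynamic limit of the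
  identity: `foldHitProb L β_c x y → g(k+2)/g(k)`, and `g(k+2) ≤ g(k+1)` by Messager–Miracle-Solé);
* `wallRepulsion_of_axisGradientRate` : `FoldedIdentity → AxisGradientRate → WallRepulsion` (two steps of the rate give
  `1 − g(k+2)/g(k) ≤ 2A/k`, and the box ratios converge to it);
* `wallRepulsion_iff_twoPointDoubling_of_foldedIdentity` : `FoldedIdentity → (WallRepulsion ↔ TwoPointDoubling)` — the
  registered sub-goal: F2 is neither a strengthening nor a weakening of the literature's open estimate, but the same
  number written as the probability of one decreasing geometric event of one sourced current of the nearest-neighbour model.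

References: M. Aizenman, *Geometric analysis of Ising models, Part III*, Math. Phys. Anal. Geom. 28 (2025) 32, Thm 14.2 and §15;
M. Aizenman, H. Duminil-Copin, Ann. Math. 194 (2021), Remark 5.10; A. Messager, S. Miracle-Solé, J. Stat. Phys. 17 (1977).
-/

noncomputable section

open Filter Topology Finset
open scoped BigOperators symmDiff
open Literature.Probability.LatticeModels
open Summit.CriticalPhenomena.Ising3DConformalLimit.Theses
open Classical

namespace Summit.CriticalPhenomena.Ising3DConformalLimit.Cruxes.ExistsScaleCovariantLimit.FoldedCurrentRepulsion

/-! ## Elementary lattice arithmetic -/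

/-- `(−e₀) − (−(k+1)e₀) = k e₀`. [folklore] -/
theorem near_sub_far (k : ℕ) :
    (Pi.single 0 (-1 : ℤ) : Site 3) - Pi.single 0 (-((k : ℤ) + 1)) = Pi.single 0 (k : ℤ) := by
  rw [← Pi.single_sub]; congr 1; ring

/-- `e₀ − (−(k+1)e₀) = (k+2) e₀`. [folklore] -/
theorem mirror_sub_far (k : ℕ) :
    (Pi.single 0 (1 : ℤ) : Site 3) - Pi.single 0 (-((k : ℤ) + 1)) = Pi.single 0 ((k + 1 + 1 : ℕ) : ℤ) := by
  rw [← Pi.single_sub]; congr 1; push_cast; ring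

/-- The far source `−(k+1)e₀` lies strictly on the negative side. [folklore] -/
theorem far_apply_zero_neg (k : ℕ) : (Pi.single 0 (-((k : ℤ) + 1)) : Site 3) 0 < 0 := by
  simp; omega

/-- The near source `−e₀` lies strictly on the negative side. [folklore] -/
theorem near_apply_zero_neg : (Pi.single 0 (-1 : ℤ) : Site 3) 0 < 0 := by simp

/-! ## The thermodynamic limit of the folded identity -/

/-- **Box ratios.** Under `FoldedIdentity`, eventually in `L` the folded hitting probability at `β_c` with sources
`x = −(k+1)e₀`, `y = −e₀` IS the ratio of box correlations `⟨σ_xσ_{e₀}⟩^∅_{Λ_L} / ⟨σ_xσ_{−e₀}⟩^∅_{Λ_L}`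
(the denominator is eventually positive: it tends to `g(k) > 0`). [folklore] -/
theorem eventually_foldHitProb_eq_ratio (h1 : FoldedIdentity) (k : ℕ) :
    ∀ᶠ L : ℕ in atTop,
      0 < isingTwoPoint (zdGraph 3) (box 3 L) (criticalBeta 3) 0 .free (Pi.single 0 (-((k : ℤ) + 1))) (Pi.single 0 (-1)) ∧
      foldHitProb L (criticalBeta 3) (Pi.single 0 (-((k : ℤ) + 1))) (Pi.single 0 (-1)) =
        isingTwoPoint (zdGraph 3) (box 3 L) (criticalBeta 3) 0 .free (Pi.single 0 (-((k : ℤ) + 1))) (Pi.single 0 1) /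
          isingTwoPoint (zdGraph 3) (box 3 L) (criticalBeta 3) 0 .free (Pi.single 0 (-((k : ℤ) + 1))) (Pi.single 0 (-1)) := by
  have hβ : 0 ≤ criticalBeta 3 := criticalBeta_nonneg 3
  have hu := tendsto_isingTwoPoint_box_sub (d := 3) hβ (Pi.single 0 (-((k : ℤ) + 1))) (Pi.single 0 (-1))
  have hfree : ∀ x : Site 3, twoPointFree 3 (criticalBeta 3) x = criticalTwoPoint 3 x := fun x =>
    (twoPointPlus_criticalBeta_eq_twoPointFree_holds (d := 3) le_rfl x).symm
  rw [hfree, near_sub_far] at hu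
  have hgk : 0 < criticalTwoPoint 3 (Pi.single 0 (k : ℤ)) := Funnel.criticalTwoPoint_axis_pos 0 k
  have hupos : ∀ᶠ L : ℕ in atTop,
      0 < isingTwoPoint (zdGraph 3) (box 3 L) (criticalBeta 3) 0 .free (Pi.single 0 (-((k : ℤ) + 1))) (Pi.single 0 (-1)) :=
    hu.eventually (lt_mem_nhds hgk)
  filter_upwards [eventually_mem_box (d := 3) (Pi.single 0 (-((k : ℤ) + 1))),
    eventually_mem_box (d := 3) (Pi.single 0 (-1 : ℤ)), hupos] with L ha hb hpos
  have hid := h1 L (criticalBeta 3) hβ _ _ ha hb (far_apply_zero_neg k) near_apply_zero_neg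
  rw [mirror_neg_e0] at hid
  refine ⟨hpos, ?_⟩
  rw [hid]; field_simp

/-- **The folded hitting probability converges to the axis ratio**: under `FoldedIdentity`,
`P^{xy}_{Λ_L,β_c}[y ⟷ 𝕏] → g(k+2)/g(k)` as `L → ∞` (`x = −(k+1)e₀`, `y = −e₀`; box limit of free pair correlations,
`⟨·⟩^∅_{β_c} = ⟨·⟩⁺_{β_c}` on `ℤ³`). [folklore] -/
theorem tendsto_foldHitProb (h1 : FoldedIdentity) (k : ℕ) :
    Tendsto (fun L : ℕ => foldHitProb L (criticalBeta 3) (Pi.single 0 (-((k : ℤ) + 1))) (Pi.single 0 (-1))) atTop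
      (𝓝 (criticalTwoPoint 3 (Pi.single 0 ((k + 1 + 1 : ℕ) : ℤ)) / criticalTwoPoint 3 (Pi.single 0 (k : ℤ)))) := by
  have hβ : 0 ≤ criticalBeta 3 := criticalBeta_nonneg 3
  have hu := tendsto_isingTwoPoint_box_sub (d := 3) hβ (Pi.single 0 (-((k : ℤ) + 1))) (Pi.single 0 (-1))
  have hv := tendsto_isingTwoPoint_box_sub (d := 3) hβ (Pi.single 0 (-((k : ℤ) + 1))) (Pi.single 0 1)
  have hfree : ∀ x : Site 3, twoPointFree 3 (criticalBeta 3) x = criticalTwoPoint 3 x := fun x =>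
    (twoPointPlus_criticalBeta_eq_twoPointFree_holds (d := 3) le_rfl x).symm
  rw [hfree, near_sub_far] at hu
  rw [hfree, mirror_sub_far] at hv
  have hgk : 0 < criticalTwoPoint 3 (Pi.single 0 (k : ℤ)) := Funnel.criticalTwoPoint_axis_pos 0 k
  refine (hv.div hu hgk.ne').congr' ?_
  filter_upwards [eventually_foldHitProb_eq_ratio h1 k] with L hL
  exact hL.2.symm

/-- **F1 ∧ F2 ⟹ the axial gradient rate** (ADC21 Remark 5.10's log-free bound): pass to the limit in
`1 − foldHitProb L ≤ A/k` and use `g(k+2) ≤ g(k+1)` (`Funnel.criticalTwoPoint_axis_antitone`, Messager–Miracle-Solé). -/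
theorem axisGradientRate_of_wallRepulsion (h1 : FoldedIdentity) (h2 : WallRepulsion) : AxisGradientRate := by
  obtain ⟨A, hA⟩ := h2
  refine ⟨A, fun k hk => ?_⟩
  have hgk : 0 < criticalTwoPoint 3 (Pi.single 0 (k : ℤ)) := Funnel.criticalTwoPoint_axis_pos 0 k
  -- the limit inequality `1 − g(k+2)/g(k) ≤ A/k`
  have hlim : 1 - criticalTwoPoint 3 (Pi.single 0 ((k + 1 + 1 : ℕ) : ℤ)) / criticalTwoPoint 3 (Pi.single 0 (k : ℤ)) ≤
      A / k :=
    le_of_tendsto (tendsto_const_nhds.sub (tendsto_foldHitProb h1 k)) (hA k hk)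
  have hmono : criticalTwoPoint 3 (Pi.single 0 ((k + 1 + 1 : ℕ) : ℤ)) ≤ criticalTwoPoint 3 (Pi.single 0 ((k + 1 : ℕ) : ℤ)) :=
    Funnel.criticalTwoPoint_axis_antitone 0 (Nat.le_succ (k + 1))
  have h1' : 1 - criticalTwoPoint 3 (Pi.single 0 ((k + 1 + 1 : ℕ) : ℤ)) / criticalTwoPoint 3 (Pi.single 0 (k : ℤ)) =
      (criticalTwoPoint 3 (Pi.single 0 (k : ℤ)) - criticalTwoPoint 3 (Pi.single 0 ((k + 1 + 1 : ℕ) : ℤ))) /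
        criticalTwoPoint 3 (Pi.single 0 (k : ℤ)) := by
    field_simp
  rw [h1'] at hlim
  have h2' : criticalTwoPoint 3 (Pi.single 0 (k : ℤ)) - criticalTwoPoint 3 (Pi.single 0 ((k + 1 + 1 : ℕ) : ℤ)) ≤
      A / k * criticalTwoPoint 3 (Pi.single 0 (k : ℤ)) := (div_le_iff₀ hgk).1 hlim
  calc criticalTwoPoint 3 (Pi.single 0 (k : ℤ)) - criticalTwoPoint 3 (Pi.single 0 ((k + 1 : ℕ) : ℤ))
      ≤ criticalTwoPoint 3 (Pi.single 0 (k : ℤ)) - criticalTwoPoint 3 (Pi.single 0 ((k + 1 + 1 : ℕ) : ℤ)) := by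
        linarith [hmono]
    _ ≤ A / k * criticalTwoPoint 3 (Pi.single 0 (k : ℤ)) := h2'
    _ = A * criticalTwoPoint 3 (Pi.single 0 (k : ℤ)) / k := by ring

/-- **F1 ∧ (the axial gradient rate) ⟹ F2**: two steps of the rate give `g(k) − g(k+2) ≤ 2A·g(k)/k` (using
`g(k+1) ≤ g(k)` and `1/(k+1) ≤ 1/k`), i.e. `1 − g(k+2)/g(k) ≤ 2A/k < (2A+1)/k`, and the folded hitting probabilities of
the boxes converge to `g(k+2)/g(k)`, so eventually `1 − foldHitProb L ≤ (2A+1)/k`. -/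
theorem wallRepulsion_of_axisGradientRate (h1 : FoldedIdentity) (hR : AxisGradientRate) : WallRepulsion := by
  obtain ⟨A, hA⟩ := hR
  have hA0 : 0 ≤ A := by
    -- the rate at `k = 1` with `g(1) − g(2) ≥ 0` and `g(1) > 0`
    have h := hA 1 le_rfl
    have hg1 : 0 < criticalTwoPoint 3 (Pi.single 0 ((1 : ℕ) : ℤ)) := Funnel.criticalTwoPoint_axis_pos 0 1
    have hmono : criticalTwoPoint 3 (Pi.single 0 ((1 + 1 : ℕ) : ℤ)) ≤ criticalTwoPoint 3 (Pi.single 0 ((1 : ℕ) : ℤ)) :=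
      Funnel.criticalTwoPoint_axis_antitone 0 (Nat.le_succ 1)
    have : 0 ≤ A * criticalTwoPoint 3 (Pi.single 0 ((1 : ℕ) : ℤ)) / (1 : ℕ) := le_trans (by linarith) h
    simp only [Nat.cast_one, div_one] at this
    exact nonneg_of_mul_nonneg_left this hg1
  refine ⟨2 * A + 1, fun k hk => ?_⟩
  have hkpos : (0 : ℝ) < k := by exact_mod_cast hk
  set g : ℕ → ℝ := fun m => criticalTwoPoint 3 (Pi.single 0 (m : ℤ)) with hg
  have hgk : 0 < g k := Funnel.criticalTwoPoint_axis_pos 0 k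
  -- two steps of the rate
  have hstep1 : g k - g (k + 1) ≤ A * g k / k := hA k hk
  have hstep2 : g (k + 1) - g (k + 1 + 1) ≤ A * g (k + 1) / (k + 1 : ℕ) := hA (k + 1) (by omega)
  have hgk1 : g (k + 1) ≤ g k := Funnel.criticalTwoPoint_axis_antitone 0 (Nat.le_succ k)
  have hgk1' : 0 ≤ g (k + 1) := (Funnel.criticalTwoPoint_axis_pos 0 (k + 1)).le
  have hstep2' : g (k + 1) - g (k + 1 + 1) ≤ A * g k / k := by
    refine hstep2.trans ?_
    rw [div_le_div_iff₀ (by positivity) hkpos]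
    have : A * g (k + 1) * (k : ℝ) ≤ A * g k * (k : ℝ) := by
      have := mul_le_mul_of_nonneg_left hgk1 hA0
      exact mul_le_mul_of_nonneg_right this hkpos.le
    refine this.trans ?_
    have hAg : 0 ≤ A * g k := mul_nonneg hA0 hgk.le
    push_cast
    nlinarith
  have htwo : g k - g (k + 1 + 1) ≤ 2 * A * g k / k := by
    have := add_le_add hstep1 hstep2'
    have e1 : g k - g (k + 1) + (g (k + 1) - g (k + 1 + 1)) = g k - g (k + 1 + 1) := by ring
    have e2 : A * g k / ↑k + A * g k / ↑k = 2 * A * g k / k := by ring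
    rw [e1, e2] at this
    exact this
  have hlimval : 1 - g (k + 1 + 1) / g k ≤ 2 * A / k := by
    rw [show 1 - g (k + 1 + 1) / g k = (g k - g (k + 1 + 1)) / g k by field_simp]
    rw [div_le_iff₀ hgk]
    calc g k - g (k + 1 + 1) ≤ 2 * A * g k / k := htwo
      _ = 2 * A / k * g k := by ring
  have hlt : 1 - g (k + 1 + 1) / g k < (2 * A + 1) / k := by
    refine hlimval.trans_lt ?_
    rw [div_lt_div_iff_of_pos_right hkpos]
    linarith
  -- the box ratios converge to `g(k+2)/g(k)`
  have hconv := tendsto_const_nhds (x := (1 : ℝ)) |>.sub (tendsto_foldHitProb h1 k)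
  have hev := hconv.eventually (gt_mem_nhds hlt)
  filter_upwards [hev] with L hL
  exact hL.le

/-- **Registered sub-goal of the line: given F1, the engine F2 is EXACTLY item 6150.**
`FoldedIdentity → (WallRepulsion ↔ MirrorHoelderCompactness.TwoPointDoubling)`, through
`Funnel.twoPointDoubling_iff_axisGradientRate` (p132478: 6150 ⟺ ADC21 Remark 5.10's log-free axial gradient bound). -/
theorem wallRepulsion_iff_twoPointDoubling_of_foldedIdentity :
    FoldedIdentity → (WallRepulsion ↔ MirrorHoelderCompactness.TwoPointDoubling) := by
  intro h1
  constructor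
  · intro h2
    exact Funnel.twoPointDoubling_iff_axisGradientRate.2 (axisGradientRate_of_wallRepulsion h1 h2)
  · intro hD
    exact wallRepulsion_of_axisGradientRate h1 (Funnel.twoPointDoubling_iff_axisGradientRate.1 hD)

/-- **First milestone of the line, by name:** F1 ∧ F2 ⟹ item 6150 `MirrorHoelderCompactness.TwoPointDoubling`. -/
theorem twoPointDoubling_of_wallRepulsion (h1 : FoldedIdentity) (h2 : WallRepulsion) :
    MirrorHoelderCompactness.TwoPointDoubling :=
  (wallRepulsion_iff_twoPointDoubling_of_foldedIdentity h1).1 h2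

end Summit.CriticalPhenomena.Ising3DConformalLimit.Cruxes.ExistsScaleCovariantLimit.FoldedCurrentRepulsion

end
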